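import Summits.HodgeConjecture.HodgeConjecture.Theorems.VHCAbelianSchemesRoadMoverFamilyOfConfinedHolds
import Summits.HodgeConjecture.HodgeConjecture.Theorems.VHCAbelianSchemesRoadSndDualInjOnMoverKernels
import Summits.HodgeConjecture.HodgeConjecture.Theorems.VHCAbelianSchemesRoadMoverTrapDefs
import HarnessLib

/-!
# LINE «twist-confined-mover-family» v2.0 — crux stmt-HodgeConjecture-26512 `DiagLocalOfMarkmanPinnedForall`, node (c4a) `PrintSheafHandleExists`
# (kept BY NAME in `Lines/birth.lean` ≥ v3.17 next to LINE N's End-trivial cut (cR)+(S2)+(S3)+(S4)); lens «transfer», seat plan-lens-HodgeAV-26512-transfer g2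

research route conditional on HC_CM; not a corollary; Q11.4-sentence-2 already refuted in dim ≥ 3. **Nothing here proves (c4a), (S4), the crux,
№4, HC_AV, HC_CM or HC; typed ≠ proved; the ONLY `sorry` is the research residue `stub_printCarrierGateExists`.**

v2.0 = v1.1 AFTER PAYING THE CRITIC'S PRICE 26512-T1 (idea-crit-6 g5). v1.1's vocabulary (`OffDiagJump`, `MoverKernelJumpConfined`,
`InjOnMoverKernels`, `TorsionSparse`, `MoverFamilyOfConfined`, the residues (c4a-T) `PrintCarrierTwistConfinedExists` ∕ (c4a-T♭)
`PrintCarrierConfinedExists`) now lives under `Theorems/` (`VHCAbelianSchemesRoadTwistConfinedMoverFamilyDefs`, p664289) and its two kernel-class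
stubs are THEOREMS there ((MM) `moverFamilyOfConfined_holds`, p664678 ∕ `…MoverFamilyOfConfinedHolds`; (inj) `sndDualInjOnMoverKernels_holds`);
this file IMPORTS them (director-hodge R16.47) and redefines nothing.

THE PENCIL (T1-2, memo `PENCIL-26512-T12.md` of this seat, from [Markman2025SecantWeil] §9.2 (F₁, F₂, 𝒢, E), §9.3 Lemma 9.3.3 (Orlov dictionary),
Lemma 9.3.5 (descent twist `D^a`, `a·8d ≡ −1 (d+1)`), Remark 9.3.7 (`q^*Ē ≅ E ⊗ D^{−a}`)) FIRED the cheapest falsifier of v1.1: the factor-2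
(C-curve-side) parameter of the `x`-piece `Ext_Y(τ_x^*Ē, Ē) ↪ Ext_{J×Ĵ}(τ_y^*E ⊗ φ_{D^{−a}}(y), E)` at a mover-kernel point `y = (−mc, φ_Θ c)` is NOT the
pure twist `pr_Ĵ(y) = φ_Θ c` but the TWISTED TRANSLATION `(translation −w_m·c, twist L_{(w_m − ℓ_m − 1)c})` with `w_m = ∓2a(2dm + d − 1)`,
`ℓ_m = ±a(2d(d−1)m + 4d)` (from `c₁(𝒢) = ±2[(d−1)(d·θ_J + θ_Ĵ) − 2d·℘]`, which passes the three congruences Lemma 9.3.5 imposes on `φ_D|_Ḡ`);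
`w_m` is a unit modulo `m² + d` off finitely many primes, so the translation part NEVER vanishes on `Ker u_m ∖ 0` at good `m`: W9 §1(b)'s
«m-uniform pure-twist table» is the `z₂ = 0` slice and holds only after an `m`-DEPENDENT re-normalisation `a ≡ 0 (m² + d)` of the descent — i.e.
for an `m`-dependent carrier, not for the ONE carrier (c4a) quantifies. CONSEQUENCES, typed below:
* (c4a-T) (`λ = pr_Ĵ`, one torsion-sparse `B ⊆ Ĵ(ℂ)`) and (c4a-T♭) as typed (ONE character, injectivity keyed to the primes of `d+1` only,
  `B` torsion-sparse) are WITHDRAWN as research targets: unsupported by print for a fixed carrier (the natural factor-2 jump set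
  `J₂ ⊂ J × J` contains the 3-dimensional abelian subvariety `{net twist trivial}` — `H¹(I_{∪Cᵢ}) = ℂ^d ≠ 0` — so it is not torsion-sparse, and the
  factor-2 map `Λ₂ : J × Ĵ → J × J` is injective on `Ker u_m` only off a finite prime set depending on `a, d`, not on `d + 1` alone).
  They remain well-typed Props under `Theorems/`; nothing refutes them; they are simply no longer what print gives.
* THE CORRECTED FIRST NON-TRANSFERRING STEP is a CONFINEMENT GATE (§1): FINITELY MANY homomorphism families `λ_i,m : J × Ĵ → A′_i` with
  torsion-sparse targets `B_i`, each injective on `Ker u_m` off the primes of `d + 1` AND off a declared finite modulus set `S`, such that every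
  off-diagonal jump on a mover kernel passes through SOME gate `λ_i,m(y) ∈ B_i`. On paper for print's `Ē` at an End-trivial datum: `i` ranges over
  the isolated torsion points and the Raynaud torsion cosets `t_i + X_{(p_i:q_i)}` of `J₂` ([Raynaud1983SousVarietes] on the 6-fold `J × J`),
  `λ_0 = Λ₂`, `λ_i = (q_i·pr₁ − p_i·pr₂) ∘ Λ₂`, `B_i = {image of t_i}`, and `S` = the primes of the resultants `Res_m(m² + d, e₁m + e₀)` of the
  moving kernel line against each coset direction (finite because the kernel-line direction `(p_m : q_m)` is non-constant in `m` for
  `a(d² − 6d + 1) ≠ ±1`). At `K`-non-simple data the same shape holds iff no `φ_d`-stable GRAPH-type subtorus of `J × Ĵ` maps into `J₁ ∩ J₂` — OPEN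
  (product-type traps `X₁ × φ_Θ X₁` are excluded by W9 §1(d): `C − C` contains no abelian coset).
* (MM2) `exists_bad_offDiagonalExtVanishing_of_gate` — the mover family from a gate — is PROVED here sorry-free over the landed key step
  `SecantQuotientDatum.exists_torsion_mem_of_isMover` (applied with `λ = 𝟙` to LIFT a kernel point of `ḡ_{u_m}` to `Ker u_m`) and
  `exists_primes_of_torsionSparse`; (MM) is its one-gate case (`gateOfConfined`).
* Compositions (sorry-free): (c4a) `PrintSheafHandleExists C` from the gate residue (c4a-G) `PrintCarrierGateExists C`; the End-keyed twin (T1-4):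
  (c4a-E) `MoverTrap.PrintSheafHandleExistsEnd C` from `PrintCarrierGateExistsEnd C`; and (c4a-T♭) ⇒ (c4a-G), (c4a-G) ⇒ (c4a-G-End).
* For LINE N's cut nothing changes: (S4) needs only PROPERNESS of the jump locus, which the single-curve table at ONE generic twist gives on paper
  (`J₂ ∌ (0, η)`, `η ∉ (C − C) ∪ 0`); (S2) (landed p667380) handles any proper closed `V` at K-simple data. This line is the cut of (c4a) that does
  NOT assume `EndTrivial` — its gate residue is exactly what must be shown about print's object at `K`-non-simple data.

References: [cite: Markman2025SecantWeil, §9.2 and §9.3 Lemma 9.3.3, Lemma 9.3.5, Remark 9.3.7, Lemma 9.3.11] [cite: Orlov2002DerivedAbelian, §2]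
[cite: Mukai1978, §3] [cite: MumfordAV1970, §7 Thm. 4 (p. 72)] [cite: Raynaud1983SousVarietes, Théorème principal]
[cite: BakerPoonen2001TorsionPackets, Theorem].
-/

noncomputable section

open CategoryTheory CategoryTheory.Limits AlgebraicGeometry

namespace Summit.HodgeConjecture.HodgeConjecture.Cruxes.DiagLocalOfMarkmanPinnedForall.TwistConfinedMoverFamily

set_option linter.dupNamespace false -- the crux namespace repeats the summit name, as in every `Ring2*` file

open Literature.AlgebraicGeometry Literature.AlgebraicGeometry.Motives Literature.AlgebraicGeometry.Motives.AbelianVariety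
open Literature.AlgebraicGeometry.HodgeTheory Literature.AlgebraicGeometry.Markman2025
open Summit.HodgeConjecture.HodgeConjecture.Ring2.SemiregularRepresentatives
open Summit.HodgeConjecture.HodgeConjecture.Ring2.SemiregularRepresentatives.TwistConfinedMoverFamily
open Summit.HodgeConjecture.HodgeConjecture.Ring2.SemiregularRepresentatives.MoverTrap

/-! ## §1 The confinement gate (finite family of characters, torsion-sparse targets, S-relative injectivity) -/

/-- **`λ_m` injective on `Ker u_m` OFF the primes of `d + 1` AND off a declared finite modulus set `S`** (`InjOnMoverKernelsOff D S λ`).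
`InjOnMoverKernels D λ` is the case `S = ∅`. For print's factor-2 map `Λ₂` the set `S` is the (finite) set of primes dividing
`2a · Res_m(m² + d, 2dm + d − 1) · Res_m(m² + d, 1 + ℓ_m)` (T1-2 pencil §4). [cite: Markman2025SecantWeil, §9.3 Lemma 9.3.3 and Lemma 9.3.5] -/
def InjOnMoverKernelsOff (D : SecantQuotientDatum) (S : Finset ℕ) {A' : AbelianVariety ℂ} (lam : ℤ → (D.P ⟶ A')) : Prop :=
  ∀ m : ℤ, (∀ p ∈ (D.d + 1).primeFactors, ¬ ((p : ℤ) ∣ m ^ 2 + (D.d : ℤ))) →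
    (∀ s ∈ S, ¬ ((s : ℤ) ∣ m ^ 2 + (D.d : ℤ))) →
      ∀ y : D.P.Points ℂ, AlgPoints.map (D.weilEndo m).hom.hom.hom y = 1 → AlgPoints.map (lam m).hom.hom.hom y = 1 → y = 1

/-- `InjOnMoverKernels` is `InjOnMoverKernelsOff` with `S = ∅`. [cite: Markman2025SecantWeil, §9.3 Lemma 9.3.3] -/
theorem injOnMoverKernelsOff_empty_of_injOnMoverKernels (D : SecantQuotientDatum) {A' : AbelianVariety ℂ} {lam : ℤ → (D.P ⟶ A')}
    (h : InjOnMoverKernels D lam) : InjOnMoverKernelsOff D ∅ lam :=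
  fun m hm _ y hU hL => h m hm y hU hL

/-- **A CONFINEMENT GATE for a carrier `E•` over the secant quotient of `D`**: finitely many (`Fin n`-indexed) abelian varieties `A′_i`,
character families `λ_i,m : J × Ĵ → A′_i`, subsets `B_i ⊆ A′_i(ℂ)` with finitely many torsion points `≠ 1`, and ONE finite modulus set `S`
(all `> 1`) such that: every off-diagonal jump of `E•` at `q(y)`, `y ∈ Ker u_m(ℂ)`, `q(y) ≠ 1`, has `λ_i,m(y) ∈ B_i` for SOME `i`
(`confined`), and each `λ_i,m` is injective on `Ker u_m(ℂ)` for `m² + d` prime to `d + 1` and to `S` (`injOff`). Print's instance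
(T1-2 pencil §5, End-trivial datum): gates = isolated torsion points of the factor-2 jump set `J₂ ⊂ J × J` and its Raynaud torsion cosets
`t_i + X_{(p_i : q_i)}`, read through `Λ₂` and the quotient maps `J × J → J` killing `X_{(p_i:q_i)}`. A structure; nothing asserted.
[cite: Markman2025SecantWeil, §9.3 Lemma 9.3.3 and Lemma 9.3.5] [cite: Raynaud1983SousVarietes, Théorème principal] [cite: Mukai1978, §3] -/
structure ConfinementGate (D : SecantQuotientDatum) (E : CochainComplex D.Y.X.left.Modules ℤ) where
  /-- number of gates -/
  n : ℕ
  /-- target abelian variety of gate `i` -/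
  A' : Fin n → AbelianVariety ℂ
  /-- the character family of gate `i` (indexed by the mover parameter `m`) -/
  lam : (i : Fin n) → ℤ → (D.P ⟶ A' i)
  /-- the receiving subset of gate `i` -/
  B : (i : Fin n) → Set ((A' i).Points ℂ)
  /-- extra bad moduli for injectivity (beyond the primes of `d + 1`) -/
  S : Finset ℕ
  one_lt : ∀ s ∈ S, 1 < s
  confined : ∀ (m : ℤ) (y : D.P.Points ℂ),
    AlgPoints.map (D.weilEndo m).hom.hom.hom y = 1 →
      AlgPoints.map D.q.hom.hom.hom y ≠ 1 →
        OffDiagJump D.Y (AlgPoints.map D.q.hom.hom.hom y) E →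
          ∃ i : Fin n, AlgPoints.map (lam i m).hom.hom.hom y ∈ B i
  injOff : ∀ i : Fin n, InjOnMoverKernelsOff D S (lam i)
  sparse : ∀ i : Fin n, TorsionSparse (B i)

/-- **v1.1's single-character confinement is a one-gate gate** ((MM)'s hypotheses ⇒ a `ConfinementGate` with `n = 1`, `S = ∅`).
[cite: Markman2025SecantWeil, §9.3 Lemma 9.3.3] -/
def gateOfConfined (D : SecantQuotientDatum) (E : CochainComplex D.Y.X.left.Modules ℤ) {A' : AbelianVariety ℂ}
    (lam : ℤ → (D.P ⟶ A')) (B : Set (A'.Points ℂ))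
    (hB : MoverKernelJumpConfined D E lam B) (hinj : InjOnMoverKernels D lam) (hT : TorsionSparse B) : ConfinementGate D E where
  n := 1
  A' := fun _ => A'
  lam := fun _ => lam
  B := fun _ => B
  S := ∅
  one_lt := fun s hs => absurd hs (Finset.notMem_empty s)
  confined := fun m y hU hQ hJ => ⟨0, hB m y hU hQ hJ⟩
  injOff := fun _ => injOnMoverKernelsOff_empty_of_injOnMoverKernels D hinj
  sparse := fun _ => hT

/-! ## §2 (MM2) PROVED: the mover family from a gate (kernel-class; the landed key step + bad primes of each `B_i` + `S`) -/

/-- **Lifting a kernel point of a mover to the mover kernel upstairs** (the landed key step `exists_torsion_mem_of_isMover` run with `λ = 𝟙`):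
for `g = ḡ_{u_m}` with `gcd(m² + d, d + 1) = 1` and `x ∈ Ker g(ℂ) ∖ 1` there is `y ∈ (J × Ĵ)(ℂ)` with `u_m y = 1`, `q y = x`, `y ≠ 1`,
`y^{m² + d} = 1`. [cite: Markman2025SecantWeil, §9.3 Lemma 9.3.3] [cite: MumfordAV1970, §7 Thm. 4 (p. 72)] -/
theorem exists_kernel_lift (D : SecantQuotientDatum) {m : ℤ} {g : D.Y ⟶ D.Y} (hg : D.IsMover m g)
    (hcop : IsCoprime (m ^ 2 + (D.d : ℤ)) ((D.d + 1 : ℕ) : ℤ)) {x : D.Y.Points ℂ} (hx : pointsMap ℂ g x = 1) (hx1 : x ≠ 1) :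
    ∃ y : D.P.Points ℂ, pointsMap ℂ (D.weilEndo m) y = 1 ∧ pointsMap ℂ D.q y = x ∧ y ≠ 1 ∧ y ^ (m ^ 2 + (D.d : ℤ)) = 1 := by
  have hid : ∀ y : D.P.Points ℂ, pointsMap ℂ (𝟙 D.P) y = y := fun y => by
    rw [pointsMap_apply, AlgPoints.map_apply]
    exact Category.comp_id _
  obtain ⟨b, hbB, hb1, hbpow⟩ := D.exists_torsion_mem_of_isMover hg hcop (𝟙 D.P)
    {y | pointsMap ℂ (D.weilEndo m) y = 1 ∧ pointsMap ℂ D.q y = x} hx hx1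
    (fun y hUy hQy => by rw [Set.mem_setOf_eq, hid]; exact ⟨hUy, hQy⟩)
    (fun y _ hLy => by rwa [hid] at hLy)
  exact ⟨b, hbB.1, hbB.2, hb1, hbpow⟩

/-- **(MM2) — THE MOVER FAMILY FROM A CONFINEMENT GATE.** If the off-diagonal jumps of `E•` on the mover kernels pass through a gate, then off
a finite set of bad moduli `> 1` (the primes of `d + 1`, the declared `S`, and the primes of the orders of the finitely many torsion points
`≠ 1` of the `B_i`) every mover `ḡ_{u_m}` satisfies `(C^∨_{u_m})` for `E•`. Proof: at a good `m`, a jump at `x ∈ Ker ḡ(ℂ) ∖ 1` lifts to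
`y ∈ Ker u_m(ℂ)` over `x` with `y^{m²+d} = 1` (`exists_kernel_lift`); some gate receives `b := λ_i,m(y) ∈ B_i`, `b ≠ 1` by injectivity,
`b^{m²+d} = 1`; a bad prime of `B_i` divides `m² + d` — contradiction. No sheaf theory. [cite: Markman2025SecantWeil, §9.3 Lemma 9.3.3]
[cite: MumfordAV1970, §7 Thm. 4 (p. 72)] [cite: Mukai1978, §3] [cite: Raynaud1983SousVarietes, Théorème principal] -/
theorem exists_bad_offDiagonalExtVanishing_of_gate (D : SecantQuotientDatum) (E : CochainComplex D.Y.X.left.Modules ℤ)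
    (G : ConfinementGate D E) :
    ∃ bad : Finset ℕ, (∀ N ∈ bad, 1 < N) ∧
      ∀ (m : ℤ) (g : D.Y ⟶ D.Y), D.IsMover m g → (∀ N ∈ bad, ¬ ((N : ℤ) ∣ m ^ 2 + (D.d : ℤ))) →
        OffDiagonalExtVanishing D.Y g E := by
  classical
  have hbi : ∀ i : Fin G.n, ∃ badB : Finset ℕ, (∀ p ∈ badB, p.Prime) ∧
      ∀ b ∈ G.B i, b ≠ 1 → ∀ N : ℤ, N ≠ 0 → b ^ N = 1 → ∃ p ∈ badB, (p : ℤ) ∣ N :=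
    fun i => exists_primes_of_torsionSparse (G.sparse i)
  choose badB hprime hbadB using hbi
  refine ⟨((D.d + 1).primeFactors ∪ G.S) ∪ Finset.univ.biUnion badB, fun N hN => ?_, fun m g hg hgood => ?_⟩
  · rcases Finset.mem_union.1 hN with h | h
    · rcases Finset.mem_union.1 h with h | h
      · exact (Nat.prime_of_mem_primeFactors h).one_lt
      · exact G.one_lt N h
    · obtain ⟨i, -, hi⟩ := Finset.mem_biUnion.1 h
      exact (hprime i N hi).one_lt
  intro x hx hx1 k
  by_contra hns
  have hk := not_subsingleton_iff_nontrivial.1 hns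
  have hgood₁ : ∀ p ∈ (D.d + 1).primeFactors, ¬ ((p : ℤ) ∣ m ^ 2 + (D.d : ℤ)) :=
    fun p hp => hgood p (Finset.mem_union_left _ (Finset.mem_union_left _ hp))
  have hgoodS : ∀ s ∈ G.S, ¬ ((s : ℤ) ∣ m ^ 2 + (D.d : ℤ)) :=
    fun s hs => hgood s (Finset.mem_union_left _ (Finset.mem_union_right _ hs))
  have hcop : IsCoprime (m ^ 2 + (D.d : ℤ)) ((D.d + 1 : ℕ) : ℤ) :=
    isCoprime_of_forall_primeFactors_not_dvd D.succ_ne_zero hgood₁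
  have hx' : pointsMap ℂ g x = 1 := (Hom.mem_kerPoints_iff _ _).1 hx
  obtain ⟨y, hUy, hQy, hy1, hypow⟩ := exists_kernel_lift D hg hcop hx' hx1
  have hQy' : AlgPoints.map D.q.hom.hom.hom y = x := hQy
  have hjump : OffDiagJump D.Y (AlgPoints.map D.q.hom.hom.hom y) E := by
    rw [hQy']
    exact ⟨k, hk⟩
  obtain ⟨i, hi⟩ := G.confined m y hUy (by rw [hQy']; exact hx1) hjump
  have hb1 : AlgPoints.map (G.lam i m).hom.hom.hom y ≠ 1 := fun h => hy1 (G.injOff i m hgood₁ hgoodS y hUy h)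
  have hbpow : (AlgPoints.map (G.lam i m).hom.hom.hom y) ^ (m ^ 2 + (D.d : ℤ)) = 1 := by
    rw [← pointsMap_apply, ← map_zpow, hypow, map_one]
  have hN : m ^ 2 + (D.d : ℤ) ≠ 0 := by
    have h4 : (4 : ℤ) ≤ (D.d : ℤ) := by exact_mod_cast D.four_le
    nlinarith [sq_nonneg m]
  obtain ⟨p, hp, hpN⟩ := hbadB i _ hi hb1 _ hN hbpow
  exact hgood p (Finset.mem_union_right _ (Finset.mem_biUnion.2 ⟨i, Finset.mem_univ _, hp⟩)) hpN

/-- (MM) is the one-gate case of (MM2) (consistency with the landed theorem `moverFamilyOfConfined_holds`; not used below).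
[cite: Markman2025SecantWeil, §9.3 Lemma 9.3.3] -/
theorem moverFamilyOfConfined_of_gate : MoverFamilyOfConfined :=
  fun D E _ lam B hB hinj hT => exists_bad_offDiagonalExtVanishing_of_gate D E (gateOfConfined D E lam B hB hinj hT)

/-! ## §3 THE CORRECTED FIRST NON-TRANSFERRING STEP: print's carrier admits a confinement gate (research residue (c4a-G)) -/

/-- **RESIDUE (c4a-G) `PrintCarrierGateExists C`** — at every non-hyperelliptic H-good pinned secant–quotient datum there are a pinned-served
class `γ`, an `AdmTw′`-admissible pinned twisted datum `𝓓` for `γ` (print: `Ē` of Remark 9.3.7 with its resolution; `AdmTw′` by Lemma 9.3.11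
at non-hyperelliptic `C`) and a CONFINEMENT GATE for `𝓓.E`. NO mover isogeny of `Y`, NO bad set occurs; `m` enters only as the index of the
kernel `Ker u_m` being tested. ON PAPER (T1-2 pencil): Orlov–Künneth box structure of `q^*Ē = E ⊗ D^{−a}` (§9.3) and faithfulness of `q^*`
(finite étale, char 0) put every jump at `q(y)` inside `Λ₁(y) ∈ J₁ ∧ Λ₂(y) ∈ J₂` for the twisted-translation parameter maps
`Λ₁, Λ₂ : J × Ĵ → J × J` and the factor jump sets `J₁, J₂`; `J₂ ≠ J × J` by the single-curve table at one generic twist (#35 §4.2–4.4);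
[Raynaud1983SousVarietes] on `J₂ ⊂ J × J`; at an End-trivial datum the gates are the isolated torsion points and cosets `t_i + X_{(p_i:q_i)}` of
`J₂`, with `S` the resultant primes of the moving kernel line (finite since the line direction is non-constant in `m`). At `K`-non-simple
data it additionally needs «no `φ_d`-stable graph-type subtorus inside `Λ₁⁻¹J₁ ∩ Λ₂⁻¹J₂`» — OPEN. RESEARCH (print's object wall + that
clause); `ChernCharacterBetti` a parameter. WEAKER than both v1.1 residues (`printCarrierGateExists_of_confinedExists`).
[cite: Markman2025SecantWeil, §9.2, §9.3 Lemma 9.3.3, Lemma 9.3.5, Remark 9.3.7 and Lemma 9.3.11] [cite: Orlov2002DerivedAbelian, §2]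
[cite: Mukai1978, §3] [cite: Raynaud1983SousVarietes, Théorème principal] -/
@[conjecture] def PrintCarrierGateExists (C : ChernCharacterBetti) : Prop :=
  ∀ (D : SecantQuotientDatum) (θ₀ : complexBetti D.𝒥.J.X 2),
    ¬ D.𝒥.IsHyperelliptic → OrbitTranslatesDisjoint D.𝒥 D.G₁ D.G₂ → D.𝒥.J.IsPolarizationClassOf D.Θ θ₀ →
      ∃ (γ : complexBetti D.Y.X (2 * 3)) (_ : γ ∈ secantQuotientServedClassesPinned D.Y.X (D.hY θ₀))
        (𝓓 : PinnedTwistedDatum C AdmTw' D.Y.X (D.hY θ₀) γ),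
        Nonempty (ConfinementGate D 𝓓.E)

/-- **RESIDUE (c4a-G-End) `PrintCarrierGateExistsEnd C`** — the same at End-trivial data only (the route's v3.12 anchor key; T1-4 twin of
the critic's ruling). [cite: Markman2025SecantWeil, Thm. 1.4.1 («generic») and §9.3 Lemma 9.3.11] -/
@[conjecture] def PrintCarrierGateExistsEnd (C : ChernCharacterBetti) : Prop :=
  ∀ (D : SecantQuotientDatum) (θ₀ : complexBetti D.𝒥.J.X 2),
    ¬ D.𝒥.IsHyperelliptic → OrbitTranslatesDisjoint D.𝒥 D.G₁ D.G₂ → D.𝒥.J.IsPolarizationClassOf D.Θ θ₀ → EndTrivial D →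
      ∃ (γ : complexBetti D.Y.X (2 * 3)) (_ : γ ∈ secantQuotientServedClassesPinned D.Y.X (D.hY θ₀))
        (𝓓 : PinnedTwistedDatum C AdmTw' D.Y.X (D.hY θ₀) γ),
        Nonempty (ConfinementGate D 𝓓.E)

/-- **STUB (c4a-G)** — the line's ONLY `sorry`: print's carrier admits a confinement gate at every non-hyperelliptic H-good datum.
RESEARCH. [cite: Markman2025SecantWeil, §9.3 Lemma 9.3.3, Lemma 9.3.5, Remark 9.3.7 and Lemma 9.3.11] -/
theorem stub_printCarrierGateExists (C : ChernCharacterBetti) : PrintCarrierGateExists C := by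
  sorry

/-- (c4a-G) ⇒ (c4a-G-End) (monotonicity). [cite: Markman2025SecantWeil, §9.3 Lemma 9.3.11] -/
theorem printCarrierGateExistsEnd_of_printCarrierGateExists (C : ChernCharacterBetti) (h : PrintCarrierGateExists C) :
    PrintCarrierGateExistsEnd C :=
  fun D θ₀ hh hH hθ _ => h D θ₀ hh hH hθ

/-- **v1.1's fallback residue implies the gate residue**: (c4a-T♭) `PrintCarrierConfinedExists C → PrintCarrierGateExists C` (one gate,
`S = ∅`); with (inj) landed, (c4a-T) implies it too. [cite: Markman2025SecantWeil, §9.3 Lemma 9.3.3] -/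
theorem printCarrierGateExists_of_confinedExists (C : ChernCharacterBetti) (h : PrintCarrierConfinedExists C) :
    PrintCarrierGateExists C := by
  intro D θ₀ hh hH hθ
  obtain ⟨γ, hγ, 𝓓, A', lam, B, hB, hinj, hsp⟩ := h D θ₀ hh hH hθ
  exact ⟨γ, hγ, 𝓓, ⟨gateOfConfined D 𝓓.E lam B hB hinj hsp⟩⟩

/-- (c4a-T) ⇒ (c4a-G), with (inj) DISCHARGED by the landed `sndDualInjOnMoverKernels_holds`. [cite: Markman2025SecantWeil, §9.3 Lemma 9.3.3] -/
theorem printCarrierGateExists_of_twistConfinedExists (C : ChernCharacterBetti) (h : PrintCarrierTwistConfinedExists C) :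
    PrintCarrierGateExists C :=
  printCarrierGateExists_of_confinedExists C (printCarrierConfinedExists_of_twistConfined C sndDualInjOnMoverKernels_holds h)

/-! ## §4 Compositions (sorry-free): (MM2) ∧ (c4a-G) → (c4a); (MM2) ∧ (c4a-G-End) → (c4a-E) -/

/-- **(c4a) from the gate residue** (the line's `_of` for the node `PrintSheafHandleExists`): the handle's carrier is the residue's `𝓓`,
its `bad` and `offDiag` fields come from (MM2). [cite: Markman2025SecantWeil, Thm. 1.4.1 and §9.3] -/
theorem printSheafHandleExists_of_gateExists (C : ChernCharacterBetti) (hG : PrintCarrierGateExists C) : PrintSheafHandleExists C := by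
  intro D θ₀ hh hH hθ
  obtain ⟨γ, hγ, 𝓓, ⟨G⟩⟩ := hG D θ₀ hh hH hθ
  obtain ⟨bad, h1, hoff⟩ := exists_bad_offDiagonalExtVanishing_of_gate D 𝓓.E G
  exact ⟨⟨γ, hγ, 𝓓, bad, h1, hoff⟩⟩

/-- **(c4a-E) from the End-keyed gate residue** (T1-4: the twin composes to LINE N's node `MoverTrap.PrintSheafHandleExistsEnd` in four lines).
[cite: Markman2025SecantWeil, Thm. 1.4.1 and §9.3] -/
theorem printSheafHandleExistsEnd_of_gateExistsEnd (C : ChernCharacterBetti) (hG : PrintCarrierGateExistsEnd C) :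
    PrintSheafHandleExistsEnd C := by
  intro D θ₀ hh hH hθ hEnd
  obtain ⟨γ, hγ, 𝓓, ⟨G⟩⟩ := hG D θ₀ hh hH hθ hEnd
  obtain ⟨bad, h1, hoff⟩ := exists_bad_offDiagonalExtVanishing_of_gate D 𝓓.E G
  exact ⟨⟨γ, hγ, 𝓓, bad, h1, hoff⟩⟩

/-- **(c4a) from the line**: the stub alone (kernel part discharged). [cite: Markman2025SecantWeil, Thm. 1.4.1 and §9.3] -/
theorem printSheafHandleExists_of (C : ChernCharacterBetti) : PrintSheafHandleExists C :=
  printSheafHandleExists_of_gateExists C (stub_printCarrierGateExists C)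

/-- **(c4a-E) from the line** (LINE N's node, via monotonicity). [cite: Markman2025SecantWeil, Thm. 1.4.1 and §9.3] -/
theorem printSheafHandleExistsEnd_of (C : ChernCharacterBetti) : PrintSheafHandleExistsEnd C :=
  printSheafHandleExistsEnd_of_gateExistsEnd C (printCarrierGateExistsEnd_of_printCarrierGateExists C (stub_printCarrierGateExists C))

end Summit.HodgeConjecture.HodgeConjecture.Cruxes.DiagLocalOfMarkmanPinnedForall.TwistConfinedMoverFamily

end
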